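import Literature.MathematicalPhysics.QuantumFieldTheory.Balaban1983to89.ClassFunctionLoopObservablesDense
import Literature.MathematicalPhysics.QuantumFieldTheory.Balaban1983to89.TraceWordsSeparateOrbitsEvenOrthogonal
import Literature.LinearAlgebra.Matrix.SimultaneousConjugacySO4
import HarnessLib

/-!
# `SO(4)`: ON `ℤ^d` THE WILSON LOOPS OF THE NATURAL REPRESENTATION TOGETHER WITH THE PFAFFIAN LOOPS
# `U ↦ p̃f(hol_ℓ(U))` SPAN THE GAUGE-INVARIANT CYLINDER OBSERVABLES — the positive even-orthogonal cell of the
# lineage's density census ([Levy2004] Thm 3.1; [AslaksenTanZhu1995] §1, Thm 3; [Yu2021] Thm 1.1)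

statement-level skeleton of published theorems with citation tags; proofs where landed; nothing here is a claim about
the Yang–Mills mass gap

Cell `lit-balaban`, unit p24 gen 22, file B of the own-lane free target (G.5-34(d); no SKELETON row).  Module XIX's
density schema `SpansGaugeInvariantCylinders d 𝒲` ([Levy2004] Thm 3.1 transported to the cylinder observables of
`ℤ^d`) is decided in the tree for the even orthogonal groups as follows: FALSE for the Wilson-loop products of the
NATURAL representation of `SO(2m)`, every `m ≥ 1` (p348765: the Pfaffian plaquette observable `p̃f(U_p)` is missed);
FALSE for ALL class-function loop products of `SO(2m)`, `m ≥ 3` (p354549, [Weidner2020] Prop. 4.5).  For `SO(4)`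
conjugacy of all products DOES determine simultaneous conjugacy (gen 21: `ProdConjDetermined SO(4)`,
`Literature/LinearAlgebra/Matrix/SimultaneousConjugacySO4`; [Yu2021] Thm 1.1 «SO(4) is acceptable»), so a positive
statement is expected; THIS FILE proves it in the sharpest concrete form — adjoining to the natural Wilson loops
exactly the invariant that defeated them:

* §1 the family `trPf : Bool → SO(4) → ℝ`: `true ↦ tr g`, `false ↦ p̃f(g) = pf(g − gᵀ)`, the Pfaffian of the skew
  projection ([AslaksenTanZhu1995] §1 p.207: «we define p̃f(M) = pf(M − Mᵗ) … This is clearly an SO(2k, F)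
  invariant»); continuous class functions on `SO(4)` (`p̃f(k X kᵀ) = det k · p̃f(X)`, tree `pfaffianSkew_conj`);
* §2 their values on `ψ(l, r) : x ↦ l x r̄` (tree `pairRot`, `S³ × S³ ↠ SO(4)`): **`tr ψ(l,r) = 4 re l · re r`** and
  **`p̃f ψ(l,r) = 4 (|l|² (re r)² − |r|² (re l)²)`** (`trace_pairRot`, `pfaffianSkew_pairRot`), `re(l²) = 2(re l)² − |l|²`;
* §3 **`exists_conj_of_trPf_eq`**: two elements of `SO(4)` with equal `tr g`, `tr g²`, `p̃f g` are conjugate IN `SO(4)` —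
  the three numbers give `(re l)², (re r)², re l · re r`, i.e. `(re l, re r)` up to the common sign `ψ(−l,−r) = ψ(l,r)`,
  and unit quaternions with equal real parts are conjugate (gen 21 `exists_unit_conj_of_re_eq`), so
  `ψ(l′,r′) = ψ(c,e) ψ(l,r) ψ(c,e)⁻¹` (the one-matrix case of [AslaksenTanZhu1995] Thm 3 for `SO(4)`; cf. the tree's
  `isConj_iff_charpoly_eq_and_skewPfaffian_eq` for `SO(2n)` indexed by `ι ⊕ ι`);
* §4 **`trPfWordsSeparateOrbits`**: for every finite `ι` and `V, W : ι → SO(4)`, if `tr w(V) = tr w(W)` and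
  `p̃f w(V) = p̃f w(W)` for every word `w`, then `W = g V g⁻¹` for one `g ∈ SO(4)` — §3 applied to `w` and `w²` makes every
  positive product conjugate, and gen 21's `exists_conj_of_forall_prod_isConj` (`ProdConjDetermined SO(4)`) concludes;
  this is [Levy2004] Prop. 3.4 for `SO(4)` with the conjugacy of `w(g)`, `w(g′)` DETECTED by `tr` and `p̃f`;
* §5 HEADLINES, every dimension `d`: **`spansGaugeInvariantCylinders_tracePfaffianLoopProducts d :
  SpansGaugeInvariantCylinders d (tracePfaffianLoopProducts d)`** — the real span of the finite products of the
  observables `U ↦ tr hol_ℓ(U)` and `U ↦ p̃f(hol_ℓ(U))` (`ℓ` based loops of `ℤ^d`) is uniformly dense in the gauge-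
  invariant bounded continuous cylinder observables of an `SO(4)` lattice gauge field (file A's orbit-Stone–Weierstrass
  and lasso transport); hence gen 20's class `classLoopProducts d SO(4)` spans
  (`spansGaugeInvariantCylinders_classLoopProducts_specialOrthogonalGroup_four`); and for the `SO(4)` Wilson theory at
  every real `β`, **`(3a)` ⟺ every trace∕Pfaffian loop correlation `⟨∏_j trPf_{b_j}(hol_{ℓ_j})⟩_{𝕋_{L+1},β}` converges**
  (`hasUniqueInfiniteVolumeLimit_iff_tendsto_tracePfaffianLoopProduct`).

So the lineage's even-orthogonal column reads: `SO(2)` abelian (module XX, `U(1)`); `SO(4)` — natural Wilson loops do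
NOT span (p348765), Wilson loops PLUS Pfaffian loops DO (this file); `SO(2m)`, `m ≥ 3` — nothing gauge-invariant built
from class functions of single loops spans (p354549).

HONEST SCOPE.  `SO(4) = Matrix.specialOrthogonalGroup (Fin 4) ℝ` only.  In print: [AslaksenTanZhu1995] Thm 3 says
the POLYNOMIAL invariants of `SO(2k)` on tuples of matrices are generated by traces and POLARIZED Pfaffians of words in
`A_i, A_iᵗ`; that orbits of tuples IN the compact group `SO(4)` are already separated by traces and UNPOLARIZED `p̃f` of
words is OUR elementary consequence of gen 21's quaternionic `ProdConjDetermined SO(4)` ([Yu2021] Thm 1.1), not a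
quotation.  [Levy2004] Thm 3.1's `SO(n)` clause (all representations) is consistent with this file for `n = 4`
(HOME/GAPS.md G-p24-g20-1 ∕ G-p24-g21-1 concern even `n ≥ 6` and the natural-representation Abstract).  Nothing about
the convergence of any expectation at any `β`; NOT summit progress.

## References

* [Levy2004] T. Lévy, J. Geom. Phys. 52 (2004) 382–397 (arXiv:math-ph/0306059 pagination): Thm 3.1, Props 3.4–3.6 p.5.
* [AslaksenTanZhu1995] H. Aslaksen, E.-C. Tan, C.-B. Zhu, *Invariant theory of special orthogonal groups*, Pacific J.
  Math. 168 (1995) 207–215: §1 p.207 (`p̃f`), Thm 3 p.209.  Held: `paper:doi-10-2140-pjm-1995-168-207`.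
* [Yu2021] J. Yu, *Acceptable compact Lie groups*, Peking Math. J. 5 (2021), Thm 1.1 (`SO(4)` acceptable).
* [EbbinghausEtAl1991] *Numbers*, GTM 123, Ch. 7 §3 (quaternionic `SO(4)`: `ψ(a,b)`).
* [Sengupta1994] A. Sengupta, Proc. AMS 121 (1994), Thm 2 p.900 (the product form of the hypothesis).
-/

noncomputable section

open Filter Topology Quaternion Matrix
open scoped Matrix Quaternion

namespace Literature.MathematicalPhysics.QuantumFieldTheory.Balaban1983to89.TracePfaffianLoopObservablesDenseSO4

open Literature.MathematicalPhysics.QuantumLattice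
open Literature.Probability.LatticeModels (zdGraph)
open Balaban1983to89.Missing (SpansGaugeInvariantCylinders)
open ClassLoopObservablesNotDenseSO8 (classLoopProducts)
open ClassFunctionLoopObservablesDense (loopClassProduct loopClassProducts spansGaugeInvariantCylinders_of_separatesOrbits
  spansGaugeInvariantCylinders_classLoopProducts_of_separatesOrbits hasUniqueInfiniteVolumeLimit_iff_tendsto_loopClassProduct)
open TraceWordsSeparateOrbitsOrthogonal (specialOrthogonalRep continuous_specialOrthogonalRep)
open TraceWordsSeparateOrbitsEvenOrthogonal (pfaffianSkew_conj)
open Literature.LinearAlgebra.Matrix (pfaffian pfMinor pfaffian_fin_add_two pfaffian_fin_four)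
open Literature.LinearAlgebra.Matrix.UnitQuaternionPairsOntoSO4 (coord e4 pairRot pairRot_mul pairRot_one pairRot_neg_neg
  pairRot_mem_specialOrthogonalGroup exists_pairRot_eq)
open Literature.LinearAlgebra.Matrix.SimultaneousConjugacySO4 (pairRot_transpose exists_unit_conj_of_re_eq
  exists_conj_of_forall_prod_isConj)

/-- `SO(4)` as Mathlib's `Matrix.specialOrthogonalGroup (Fin 4) ℝ`. [cite: EbbinghausEtAl1991, Ch. 7 §3.4 (SO(ℍ) = SO(4))] -/
abbrev SO4 : Type := Matrix.specialOrthogonalGroup (Fin 4) ℝ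

/-! ## §1 The family `{tr, p̃f}` of continuous class functions on `SO(4)` -/

section Family

/-- For a real matrix `star = transpose`. [folklore] -/
private theorem star_eq_transpose' (A : Matrix (Fin 4) (Fin 4) ℝ) : star A = Aᵀ := by
  rw [Matrix.star_eq_conjTranspose, Matrix.conjTranspose_eq_transpose_of_trivial]

/-- The Pfaffian is continuous (a polynomial in the entries; induction over `pfaffian_fin_add_two`). [folklore] -/
private theorem continuous_pfaffian : ∀ {n : ℕ}, Continuous fun A : Matrix (Fin n) (Fin n) ℝ => pfaffian A
  | 0 => continuous_const
  | 1 => continuous_const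
  | n + 2 => by
      have ih : Continuous fun A : Matrix (Fin n) (Fin n) ℝ => pfaffian A := continuous_pfaffian
      simp only [pfaffian_fin_add_two]
      refine continuous_finsetSum _ fun j _ => ?_
      refine (continuous_const.mul (continuous_id.matrix_elem 0 j.succ)).mul ?_
      exact ih.comp (continuous_id.matrix_submatrix _ _)

/-- **THE FAMILY `{tr, p̃f}` ON `SO(4)`**: `trPf true g = tr g` (the character of the natural representation) and
`trPf false g = p̃f(g) = pf(g − gᵀ)`, the Pfaffian of the skew-symmetric projection («For an arbitrary 2k × 2k matrix M,
we define p̃f(M) = pf(M − Mᵗ) … This is clearly an SO(2k, F) invariant»). [cite: AslaksenTanZhu1995, §1 p.207] -/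
def trPf : Bool → SO4 → ℝ
  | true => fun g => (g : Matrix (Fin 4) (Fin 4) ℝ).trace
  | false => fun g => pfaffian ((g : Matrix (Fin 4) (Fin 4) ℝ) - (g : Matrix (Fin 4) (Fin 4) ℝ)ᵀ)

/-- `trPf true g = tr g`. [cite: AslaksenTanZhu1995, §1 p.207 and Thm 3 p.209 (traces)] -/
@[simp] theorem trPf_true (g : SO4) : trPf true g = (g : Matrix (Fin 4) (Fin 4) ℝ).trace := rfl

/-- `trPf false g = p̃f g`. [cite: AslaksenTanZhu1995, §1 p.207 (p̃f)] -/
@[simp] theorem trPf_false (g : SO4) :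
    trPf false g = pfaffian ((g : Matrix (Fin 4) (Fin 4) ℝ) - (g : Matrix (Fin 4) (Fin 4) ℝ)ᵀ) := rfl

/-- Both members of the family are continuous. [cite: AslaksenTanZhu1995, §1 p.207 (polynomial invariants)] -/
theorem continuous_trPf : ∀ b : Bool, Continuous (trPf b)
  | true => by
    have hval : Continuous fun g : SO4 => (g : Matrix (Fin 4) (Fin 4) ℝ) := continuous_subtype_val
    show Continuous fun g : SO4 => (g : Matrix (Fin 4) (Fin 4) ℝ).trace
    exact hval.matrix_trace
  | false => by
    have hval : Continuous fun g : SO4 => (g : Matrix (Fin 4) (Fin 4) ℝ) := continuous_subtype_val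
    show Continuous fun g : SO4 => pfaffian ((g : Matrix (Fin 4) (Fin 4) ℝ) - (g : Matrix (Fin 4) (Fin 4) ℝ)ᵀ)
    exact continuous_pfaffian.comp (hval.sub hval.matrix_transpose)

/-- Both members of the family are CLASS FUNCTIONS on `SO(4)`: the trace by cyclicity, `p̃f` by `p̃f(k X kᵀ) = det k · p̃f(X)`
with `det k = 1`. [cite: AslaksenTanZhu1995, §1 p.207 («clearly an SO(2k, F) invariant»)] -/
theorem trPf_conj : ∀ (b : Bool) (a y : SO4), trPf b (y * a * y⁻¹) = trPf b a
  | true, a, y => by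
    have hy : star (y : Matrix (Fin 4) (Fin 4) ℝ) * y = 1 := Matrix.mem_unitaryGroup_iff'.mp y.2.1
    simp only [trPf_true]
    rw [← Matrix.star_eq_inv, Submonoid.coe_mul, Submonoid.coe_mul, Matrix.specialUnitaryGroup.coe_star,
      Matrix.trace_mul_cycle, hy, Matrix.one_mul]
  | false, a, y => by
    have hdet : (y : Matrix (Fin 4) (Fin 4) ℝ).det = 1 := (Matrix.mem_specialUnitaryGroup_iff.mp y.2).2
    simp only [trPf_false]
    rw [← Matrix.star_eq_inv, Submonoid.coe_mul, Submonoid.coe_mul, Matrix.specialUnitaryGroup.coe_star,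
      pfaffianSkew_conj, hdet, one_mul]

end Family

/-! ## §2 The values of `tr` and `p̃f` on `ψ(l, r)` -/

section PairRotValues

/-- **`tr ψ(l, r) = 4 re l · re r`** (the character of the natural representation of `SO(4) = (S³ × S³)/±1` is the
product of the two `SU(2)` characters). [cite: EbbinghausEtAl1991, Ch. 7 §3.4 (ψ(a,b): x ↦ a x b̄)] -/
theorem trace_pairRot (l r : ℍ) : (pairRot l r).trace = 4 * (l.re * r.re) := by
  rw [Matrix.trace, Fin.sum_univ_four]
  simp [pairRot, coord, e4]
  ring

/-- **`p̃f ψ(l, r) = 4 (|l|² (re r)² − |r|² (re l)²)`** — the skew Pfaffian separates the two chiral factors which the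
trace sees symmetrically. [cite: AslaksenTanZhu1995, §1 p.207 (p̃f(M) = pf(M − Mᵗ))] -/
theorem pfaffianSkew_pairRot (l r : ℍ) :
    pfaffian (pairRot l r - (pairRot l r)ᵀ) = 4 * (normSq l * r.re ^ 2 - normSq r * l.re ^ 2) := by
  rw [pfaffian_fin_four]
  simp [Matrix.sub_apply, Matrix.transpose_apply, pairRot, coord, e4, Quaternion.normSq_def']
  ring

/-- `re(l²) = 2 (re l)² − |l|²`. [cite: EbbinghausEtAl1991, Ch. 7 §1.1 (the product formula) and §2.1 (Re, conjugation)] -/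
theorem re_mul_self (l : ℍ) : (l * l).re = 2 * l.re ^ 2 - normSq l := by
  rw [Quaternion.re_mul, Quaternion.normSq_def']
  ring

end PairRotValues

/-! ## §3 `tr g`, `tr g²`, `p̃f g` determine the conjugacy class in `SO(4)` -/

section OneElement

/-- Sign bookkeeping (real arithmetic): `ab = a′b′`, `a² = a′²`, `b² = b′²` force `(a′, b′) = ±(a, b)` with a COMMON
sign. [folklore] -/
private theorem eq_or_eq_neg_of_mul_eq_of_sq_eq {a b a' b' : ℝ} (h1 : a * b = a' * b') (h2 : a ^ 2 = a' ^ 2)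
    (h3 : b ^ 2 = b' ^ 2) : (a' = a ∧ b' = b) ∨ (a' = -a ∧ b' = -b) := by
  rcases sq_eq_sq_iff_eq_or_eq_neg.1 h2.symm with ha | ha <;> rcases sq_eq_sq_iff_eq_or_eq_neg.1 h3.symm with hb | hb
  · exact Or.inl ⟨ha, hb⟩
  · -- `a' = a`, `b' = -b`: then `ab = 0`
    have hab : a * b = 0 := by rw [ha, hb] at h1; linarith
    rcases mul_eq_zero.1 hab with h0 | h0
    · refine Or.inr ⟨?_, hb⟩
      rw [ha, h0, neg_zero]
    · refine Or.inl ⟨ha, ?_⟩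
      rw [hb, h0, neg_zero]
  · -- `a' = -a`, `b' = b`: then `ab = 0`
    have hab : a * b = 0 := by rw [ha, hb] at h1; linarith
    rcases mul_eq_zero.1 hab with h0 | h0
    · refine Or.inl ⟨?_, hb⟩
      rw [ha, h0, neg_zero]
    · refine Or.inr ⟨ha, ?_⟩
      rw [hb, h0, neg_zero]
  · exact Or.inr ⟨ha, hb⟩

/-- Conjugating both quaternion parameters conjugates `ψ`: `ψ(c l c̄, e r ē) = ψ(c,e) ψ(l,r) ψ(c,e)ᵀ`.
[cite: EbbinghausEtAl1991, Ch. 7 §3.4 Theorem (ψ is a homomorphism; ψ(a,b)⁻¹ = ψ(ā, b̄))] -/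
theorem pairRot_conj_conj (c e l r : ℍ) :
    pairRot (c * l * star c) (e * r * star e) = pairRot c e * pairRot l r * (pairRot c e)ᵀ := by
  rw [pairRot_transpose, pairRot_mul, pairRot_mul]

/-- **`tr g = tr h`, `tr g² = tr h²`, `p̃f g = p̃f h` ⟹ `g` AND `h` ARE CONJUGATE IN `SO(4)`** (the conjugacy class of
`ψ(l, r)` is the pair `(re l, re r)` up to a common sign; the one-matrix case of the `SO(2k)` invariants «traces and
polarized Pfaffians» for `k = 2`). [cite: AslaksenTanZhu1995, Thm 3 p.209; EbbinghausEtAl1991, Ch. 7 §3.4 Theorem] -/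
theorem exists_conj_of_trPf_eq {g h : SO4}
    (h1 : (g : Matrix (Fin 4) (Fin 4) ℝ).trace = (h : Matrix (Fin 4) (Fin 4) ℝ).trace)
    (h2 : ((g * g : SO4) : Matrix (Fin 4) (Fin 4) ℝ).trace = ((h * h : SO4) : Matrix (Fin 4) (Fin 4) ℝ).trace)
    (h3 : pfaffian ((g : Matrix (Fin 4) (Fin 4) ℝ) - (g : Matrix (Fin 4) (Fin 4) ℝ)ᵀ) =
      pfaffian ((h : Matrix (Fin 4) (Fin 4) ℝ) - (h : Matrix (Fin 4) (Fin 4) ℝ)ᵀ)) :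
    ∃ y : SO4, h = y * g * y⁻¹ := by
  obtain ⟨l, r, hl, hr, hg⟩ := exists_pairRot_eq g.2
  obtain ⟨l', r', hl', hr', hh⟩ := exists_pairRot_eq h.2
  -- the three invariants in terms of `a = re l`, `b = re r`, `a' = re l'`, `b' = re r'`
  rw [← hg, ← hh, trace_pairRot, trace_pairRot] at h1
  rw [Submonoid.coe_mul, Submonoid.coe_mul, ← hg, ← hh, ← pairRot_mul, ← pairRot_mul, trace_pairRot, trace_pairRot,
    re_mul_self, re_mul_self, re_mul_self, re_mul_self, hl, hr, hl', hr'] at h2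
  rw [← hg, ← hh, pfaffianSkew_pairRot, pfaffianSkew_pairRot, hl, hr, hl', hr'] at h3
  have e1 : l.re * r.re = l'.re * r'.re := by linarith
  have e2 : l.re ^ 2 = l'.re ^ 2 := by
    linear_combination (-1 / 16 : ℝ) * h2 + (-1 / 8 : ℝ) * h3 + (l.re * r.re + l'.re * r'.re) * e1
  have e3 : r.re ^ 2 = r'.re ^ 2 := by
    linear_combination (-1 / 16 : ℝ) * h2 + (1 / 8 : ℝ) * h3 + (l.re * r.re + l'.re * r'.re) * e1
  -- a common sign `ε` with `re(ε l') = re l`, `re(ε r') = re r`; replace `(l', r')` by `(ε l', ε r')`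
  obtain ⟨l'', r'', hl'', hr'', hre1, hre2, hh''⟩ : ∃ l'' r'' : ℍ, normSq l'' = 1 ∧ normSq r'' = 1 ∧
      l.re = l''.re ∧ r.re = r''.re ∧ pairRot l'' r'' = (h : Matrix (Fin 4) (Fin 4) ℝ) := by
    rcases eq_or_eq_neg_of_mul_eq_of_sq_eq e1 e2 e3 with ⟨ha, hb⟩ | ⟨ha, hb⟩
    · exact ⟨l', r', hl', hr', ha.symm, hb.symm, hh⟩
    · refine ⟨-l', -r', by rw [normSq_neg, hl'], by rw [normSq_neg, hr'], ?_, ?_, by rw [pairRot_neg_neg, hh]⟩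
      · rw [Quaternion.re_neg, ha, neg_neg]
      · rw [Quaternion.re_neg, hb, neg_neg]
  obtain ⟨c, hc, hcl⟩ := exists_unit_conj_of_re_eq hl hl'' hre1
  obtain ⟨e, he, her⟩ := exists_unit_conj_of_re_eq hr hr'' hre2
  have hySO : pairRot c e ∈ Matrix.specialOrthogonalGroup (Fin 4) ℝ := pairRot_mem_specialOrthogonalGroup hc he
  refine ⟨⟨pairRot c e, hySO⟩, Subtype.ext ?_⟩
  change (h : Matrix (Fin 4) (Fin 4) ℝ) = pairRot c e * (g : Matrix (Fin 4) (Fin 4) ℝ) *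
    ((⟨pairRot c e, hySO⟩ : SO4)⁻¹ : SO4)
  rw [← Matrix.star_eq_inv, Matrix.specialUnitaryGroup.coe_star]
  change (h : Matrix (Fin 4) (Fin 4) ℝ) = pairRot c e * (g : Matrix (Fin 4) (Fin 4) ℝ) * star (pairRot c e)
  rw [star_eq_transpose', ← hg, ← pairRot_conj_conj, hcl, her, hh'']

end OneElement

/-! ## §4 Traces and skew Pfaffians of words separate the simultaneous-conjugation orbits of `SO(4)^ι` -/

section Words

/-- The positive word of a list of indices: `wordVal (l.map (·, true)) V = ∏_{i ∈ l} V i`. [cite: Levy2004, Example 3.3 p.5] -/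
theorem wordVal_map_true {G : Type*} [Group G] {ι : Type*} (l : List ι) (V : ι → G) :
    wordVal (l.map fun i => (i, true)) V = (l.map V).prod := by
  induction l with
  | nil => simp
  | cons i l ih => simp [ih, letterVal]

/-- Concatenation of words multiplies their values. [cite: Levy2004, Example 3.3 p.5] -/
theorem wordVal_append {G : Type*} [Group G] {ι : Type*} (w₁ w₂ : List (ι × Bool)) (V : ι → G) :
    wordVal (w₁ ++ w₂) V = wordVal w₁ V * wordVal w₂ V := by
  simp [wordVal, List.map_append, List.prod_append]

/-- **[Levy2004] PROP. 3.4 FOR `SO(4)`, DETECTED BY `tr` AND `p̃f`**: for every finite `ι` and `V, W : ι → SO(4)`, if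
`tr w(V) = tr w(W)` and `p̃f w(V) = p̃f w(W)` for every word `w` in the letters `i^{±1}`, then `W = g V g⁻¹` for a single
`g ∈ SO(4)`.  (§3 on `w` and `w·w` makes all positive products conjugate in `SO(4)`; gen 21's
`exists_conj_of_forall_prod_isConj` — `ProdConjDetermined SO(4)`, [Yu2021] Thm 1.1 — concludes.)
[cite: Levy2004, Prop 3.4 p.5; Yu2021, Thm 1.1 (SO(4) acceptable)] -/
theorem trPfWordsSeparateOrbits (ι : Type) [Fintype ι] (V W : ι → SO4)
    (h : ∀ (w : List (ι × Bool)) (b : Bool), trPf b (wordVal w V) = trPf b (wordVal w W)) :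
    ∃ g : SO4, ∀ i, W i = g * V i * g⁻¹ := by
  refine exists_conj_of_forall_prod_isConj V W fun l => ?_
  set w : List (ι × Bool) := l.map fun i => (i, true) with hw
  have hV : (l.map V).prod = wordVal w V := (wordVal_map_true l V).symm
  have hW : (l.map W).prod = wordVal w W := (wordVal_map_true l W).symm
  have h1 := h w true
  have h2 := h (w ++ w) true
  have h3 := h w false
  simp only [trPf_true, trPf_false, wordVal_append] at h1 h2 h3
  obtain ⟨y, hy⟩ := exists_conj_of_trPf_eq h1 h2 h3
  rw [hV, hW]
  exact isConj_iff.2 ⟨y, hy.symm⟩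

end Words

/-! ## §5 HEADLINES: trace + Pfaffian loop observables span; `(3a)` ⟺ their correlations converge -/

section Headlines

variable {d : ℕ}

/-- **THE TRACE∕PFAFFIAN LOOP OBSERVABLES OF `SO(4)` ON `ℤ^d`**: all finite products of the observables
`U ↦ tr hol_ℓ(U)` (the natural Wilson loops) and `U ↦ p̃f(hol_ℓ(U))` (the Pfaffian loops), `ℓ` based closed walks —
file A's `loopClassProducts` for the family `trPf`. [cite: Levy2004, §2 p.4 and Remark 2.4; AslaksenTanZhu1995, §1 p.207] -/
def tracePfaffianLoopProducts (d : ℕ) : Set (LGConfig d SO4 → ℝ) := loopClassProducts trPf d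

/-- Unfolding. [cite: Levy2004, §2 p.4 and Remark 2.4] -/
theorem tracePfaffianLoopProducts_eq (d : ℕ) : tracePfaffianLoopProducts d = loopClassProducts trPf d := rfl

/-- The trace∕Pfaffian loop products are gauge-invariant class-function loop products (gen 20's class).
[cite: Levy2004, §2 p.4 and Remark 2.4] -/
theorem tracePfaffianLoopProducts_subset_classLoopProducts (d : ℕ) :
    tracePfaffianLoopProducts d ⊆ classLoopProducts d SO4 :=
  ClassFunctionLoopObservablesDense.loopClassProducts_subset_classLoopProducts trPf trPf_conj

/-- **HEADLINE — `SO(4)`: WILSON LOOPS PLUS PFAFFIAN LOOPS SPAN**, in every dimension `d`: the real span of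
`tracePfaffianLoopProducts d` is uniformly dense in the gauge-invariant bounded continuous cylinder observables of an
`SO(4)` lattice gauge field on `ℤ^d` (`SpansGaugeInvariantCylinders`, module XIX's form of [Levy2004] Thm 3.1) — whereas
the natural Wilson loops alone are not (p348765). [cite: Levy2004, Thm 3.1 and Props 3.4–3.6 p.5; AslaksenTanZhu1995, Thm 3 p.209] -/
theorem spansGaugeInvariantCylinders_tracePfaffianLoopProducts (d : ℕ) :
    SpansGaugeInvariantCylinders d (tracePfaffianLoopProducts d) :=
  spansGaugeInvariantCylinders_of_separatesOrbits trPf continuous_trPf trPfWordsSeparateOrbits d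

/-- **COROLLARY — `SO(4)`: gen 20's class of ALL class-function loop products spans** (FALSE for `SO(8)`, p352515, and
for every `SO(2m)`, `m ≥ 3`, p354549). [cite: Levy2004, Thm 3.1 p.5; Yu2021, Thm 1.1] -/
theorem spansGaugeInvariantCylinders_classLoopProducts_specialOrthogonalGroup_four (d : ℕ) :
    SpansGaugeInvariantCylinders d (classLoopProducts d SO4) :=
  spansGaugeInvariantCylinders_classLoopProducts_of_separatesOrbits trPf continuous_trPf trPf_conj
    trPfWordsSeparateOrbits d

/-- `SO(4)` is second countable (a subspace of `Matrix (Fin 4) (Fin 4) ℝ`). [folklore] -/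
private theorem specialOrthogonalGroup_four_secondCountable : SecondCountableTopology SO4 :=
  haveI : SecondCountableTopology (Matrix (Fin 4) (Fin 4) ℝ) :=
    inferInstanceAs (SecondCountableTopology (Fin 4 → Fin 4 → ℝ))
  Topology.IsEmbedding.subtypeVal.secondCountableTopology

/-- **HEADLINE — `SO(4)` WILSON THEORY: `(3a)` ⟺ EVERY TRACE∕PFAFFIAN LOOP CORRELATION HAS A THERMODYNAMIC LIMIT**
(natural representation `specialOrthogonalRep (Fin 4)` in the Wilson action; every `d`, every real `β`): the torus
states have a unique infinite-volume limit iff for every finite list of based loops `ℓ_j` with tags `b_j ∈ {tr, p̃f}`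
the torus expectation `⟨∏_j trPf_{b_j}(hol_{ℓ_j})⟩_{𝕋_{L+1},β}` converges as `L → ∞`.  For `SO(4)` the Wilson-loop
correlations ALONE are not known to decide `(3a)` (their span is not dense); with the Pfaffian loops they do.
[cite: Levy2004, Thm 3.1 p.5] -/
theorem hasUniqueInfiniteVolumeLimit_iff_tendsto_tracePfaffianLoopProduct (d : ℕ) (β : ℝ) :
    HasUniqueInfiniteVolumeLimit (d := d) (specialOrthogonalRep (Fin 4)) β ↔
      ∀ l : List ((Σ x : (Fin d → ℤ), (zdGraph d).Walk x x) × Bool), ∃ lim : ℝ,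
        Tendsto (fun L : ℕ => wilsonExpectation (L := L + 1) (specialOrthogonalRep (Fin 4)) β
          (toTorusObservable (L + 1) (loopClassProduct trPf l))) atTop (𝓝 lim) := by
  haveI := specialOrthogonalGroup_four_secondCountable
  exact hasUniqueInfiniteVolumeLimit_iff_tendsto_loopClassProduct _ trPf (continuous_specialOrthogonalRep (Fin 4)) β
    continuous_trPf trPfWordsSeparateOrbits

end Headlines

end Literature.MathematicalPhysics.QuantumFieldTheory.Balaban1983to89.TracePfaffianLoopObservablesDenseSO4
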